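/-
Copyright (c) 2026 the pub-hodgecm-mathlib formalisation cell (harness21).  Prover seat hodgecm-mathlib-K2E4-p10 (g7), Track B ∕ K2-LIT, h413 = `stmt-HodgeConjecture-24833`,
line `K2_E1_TraceFormulaBeta`, 5Res ROADCARD AMENDMENT #3 rung G8 (dealer K2E1-plan (g7) (274)(iv)) STEP 2: the MATRIX functional equation of the `(χ,τ)` scattering coordinates of a
SELF-DUAL `χ` AT A GENERAL LEVEL `(K′, ω)` — ★ p860949∕ED.2 `chi_scattering_matrix_fe_cm_two_of_eigen` INSTANTIATED on the eigen ball packages (★ K2-defs1 p860811) of a basis family of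
`V(χ, K′, ω)`: one package per basis element serves both the χ-side (its column) and the χʷ-side (its dual datum), as ★ p860766 did at rank one.
-/
import Summits.HodgeConjecture.HodgeConjecture.Theorems.K2E1ChiScatteringMatrixFunctionalEquationCMTwoGlobal   -- ★ p860949 + ED.2 (this seat): `chi_scattering_matrix_fe_cm_two_of_eigen`
import Summits.HodgeConjecture.HodgeConjecture.Theorems.K2E1ChiEisensteinBallPackageCMTwoEigen              -- ★ p860811 (K2-defs1): `exists_chi_ball_package_cm_two_of_eigen`
import Summits.HodgeConjecture.HodgeConjecture.Theorems.K2E1ChiScatteringFunctionalEquationM1CMTwo           -- ★ p860766 (K2E1-p13): `swap_of_ae`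
import HarnessLib

/-!
# G8 STEP 2 — `K2E1ChiScatteringMatrixFunctionalEquationLevelCMTwo`: THE MATRIX FUNCTIONAL EQUATION `M(1 − z)·M(z) = 1` OF THE SCATTERING COORDINATES OF A SELF-DUAL `χ` AT LEVEL `(K′, ω)`,
# hypothesis-first on the ball's (χ,τ) convolution data (★ p860739 clauses as binders) + the eigenvalue symmetry letter `hsym` + the tube coordinates and global pieces of a basis family

Track B ∕ K2-LIT, crux h413 = `stmt-HodgeConjecture-24833`, route of record `HCCMUnconditional`; cell `hodgecm-mathlib`, squad K2, ENGINE E1; AMENDMENT #3 rung G8 («matrix hFE at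
dim V > 1»), ruling (274)(iv) «GO — nobody holds the level matrix FE; K2-defs1's eigen ball package ★ p860811 is your matrix package at level».  THEOREMS ONLY (no `def`, no `instance`, no
`notation`, no named-fact hypothesis, no `sorry`; default heartbeats); lane `--supports stmt-HodgeConjecture-24833 --as helper` (count-neutral).
THE MATHEMATICS ([BernsteinLapid2019, §4 Claims 2–5, §5]; [MoeglinWaldspurger1995, IV.1.8–IV.1.10]).  Fix a self-dual `χ` (`χʷ = χ`), a level `(K′, ω)`, the (χ,τ) convolution data of
the ball `D_n` (binders = ★ `exists_chi_convData_level_cm_two`'s clauses: test functions `η_i`, eigenvalues `ŝ_i`, operators `T_i`, …, the scalar action `hact` on all of `V(χ,K′,ω) ⊗ H^z`) and a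
linearly independent family `b : Λ → V(χ, K′, ω)` of continuous bounded sections (a basis).  For EACH `k ∈ Λ` the eigen ball package ★ p860811 of `φ := b_k` with columns over `φ′ := b`
(a χʷ-family by `χʷ = χ`) gives `(U_k, vX_k, cc_k, α₁_k, col_k)`; the columns of different `k` coincide (`col_k j z = col_{k₀} j z`, both a.e. `= [f^{b_j}_{1−z}]`, `Lp.ext`) and the
reduction letter `IotaBound` is a `Prop`, so the packages form a χ-FAMILY on `U := ⋂_k U_k` in the sense of ★ ED.2; the package of `k = j₀` is at the same time the χʷ-package of the dual
datum `b_{j₀}`; the swap identities are `Lp.ext` of the a.e. clauses (as in ★ p860766); the tube agreement is the Godement clause + `hqcq`.  ★ ED.2 then yields, for the global pieces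
`qc k j` (★ p860855's per-`φ` exports, all in ONE pole set `P`), **`∀ z ∉ P, 1 − z ∉ P → ∀ j₀ j, Σ_k qc j₀ k (1 − z)·qc k j z = δ_{j j₀}`** — i.e. `M(z)·M(1−z) = 1` in the basis `b`
(`(M_z)_{jk} = qc k j z`), the `hmFE` letter of ★ p860910 `hFE_of_coords` (at `1 − z`).  VISIBLE LETTER: `hsym : ŝ_i(1 − z) = ŝ_i(z)` (hsymm_τ: ★ p860867∕p860913's road, or ★ (G1) when the
`h_i` are left-`K_max`-invariant) — NOTE for its payer: it must NOT be derived from this matrix FE (no circularity through `hMne`).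
* HEAD **`chi_scattering_matrix_fe_level_cm_two`**.
HONEST LABEL: HC_CM is proved only modulo the 7 printed citations (2 remaining named inputs: hLiu418 = `stmt-HodgeConjecture-24832`, h413 = `stmt-HodgeConjecture-24833`) until rung 0
closes; this file asserts no named fact and closes no socket; count-neutral; hypothesis-first on the convData clauses, `hsym`, the tube coordinates and the global pieces.

## References
* [BernsteinLapid2019] J. Bernstein, E. Lapid, *On the meromorphic continuation of Eisenstein series*, J. AMS 37 (2024), §4 Claims 2–5, §5.
* [MoeglinWaldspurger1995] C. Mœglin, J.-L. Waldspurger, *Spectral decomposition and Eisenstein series* (1995), IV.1.8–IV.1.10.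
-/

set_option autoImplicit false
set_option linter.dupNamespace false  -- the mandated namespace repeats the summit's segment (`HodgeConjecture.HodgeConjecture`)

noncomputable section

open MeasureTheory Measure Filter Topology Set NumberField IsDedekindDomain
open scoped NNReal ENNReal ComplexConjugate BigOperators
open Literature.MeasureTheory.Group Literature.NumberTheory Literature.NumberTheory.Automorphic Literature.NumberTheory.Automorphic.UnitaryGroup AdelicGroupData
open Literature.NumberTheory.GaloisRepresentations (HeckeCharacter)
open Summit.HodgeConjecture.HodgeConjecture.Cruxes.H413.K2E1BorelEisensteinU
open Summit.HodgeConjecture.HodgeConjecture.Cruxes.H413.K2E1BLBorelSpacesU2Defs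
open Summit.HodgeConjecture.HodgeConjecture.Cruxes.H413.K2E1BLBorelOperatorsU2Defs
open Summit.HodgeConjecture.HodgeConjecture.Cruxes.H413.K2E1CharacterEisensteinU2Defs
open Summit.HodgeConjecture.HodgeConjecture.Cruxes.H413.K2E1ChiSectionSpaceU2Defs
open Summit.HodgeConjecture.HodgeConjecture.Cruxes.H413.K2E1ChiEisensteinBallPackageCMTwoEigen (exists_chi_ball_package_cm_two_of_eigen)
open Summit.HodgeConjecture.HodgeConjecture.Cruxes.H413.K2E1BLIotaClosedEmbeddingU2 (iotaBound_cm)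
open Summit.HodgeConjecture.HodgeConjecture.Cruxes.H413.K2E1ChiScatteringFunctionalEquationM1CMTwo (swap_of_ae)
open Summit.HodgeConjecture.HodgeConjecture.Cruxes.H413.K2E1ChiScatteringMatrixFunctionalEquationCMTwoGlobal (chi_scattering_matrix_fe_cm_two_of_eigen)

namespace Summit.HodgeConjecture.HodgeConjecture.Cruxes.H413.K2E1ChiScatteringMatrixFunctionalEquationLevelCMTwo

variable (L : Type) [Field L] [NumberField L] [IsCMField L]
  [MeasurableSpace (quasiSplit (↥(maximalRealSubfield L)) L (IsCMField.complexConj L) 2).Adelic] [BorelSpace (quasiSplit (↥(maximalRealSubfield L)) L (IsCMField.complexConj L) 2).Adelic]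

/-- **HEAD — THE MATRIX FUNCTIONAL EQUATION OF THE SCATTERING COORDINATES OF A SELF-DUAL `χ` AT LEVEL `(K′, ω)`** (module docstring).  Binders: the structural data (`μ νG ν 𝓕 β μZ`), the
ball's (χ,τ) convolution data as binders (★ `exists_chi_convData_level_cm_two`'s clauses — plug its `obtain` components here), the symmetry letter `hsym`, the self-dual `χ`, a linearly
independent family `b : Λ → V(χ,K′,ω)` of continuous bounded sections with the scalar action `hact` of the `h_i` on every `f_z^{b_k}`, tube coordinates `q k` (`hq`), and global pieces
`qc k j` off ONE closed co-discrete `P ⊆ {Re ≤ 1}` with `hqcq`, `hqa`.  CONCLUSION: `∀ z ∉ P, 1 − z ∉ P → ∀ j₀ j, Σ_k qc j₀ k (1 − z)·qc k j z = δ_{j j₀}`.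
[cite: BernsteinLapid2019, §4 Claims 2–5 and §5] [cite: MoeglinWaldspurger1995, IV.1.8–IV.1.10] -/
theorem chi_scattering_matrix_fe_level_cm_two
    (μ : Measure (quasiSplit (↥(maximalRealSubfield L)) L (IsCMField.complexConj L) 2).automorphicQuotient) [(quasiSplit (↥(maximalRealSubfield L)) L (IsCMField.complexConj L) 2).IsAutomorphicMeasure μ]
    (νG : Measure (quasiSplit (↥(maximalRealSubfield L)) L (IsCMField.complexConj L) 2).Adelic) [νG.IsHaarMeasure] [νG.IsInvInvariant] [SFinite νG]
    (ν : Measure ↥(adelicUnipotent (↥(maximalRealSubfield L)) L (IsCMField.complexConj L) 2)) [ν.IsHaarMeasure] [ν.IsMulRightInvariant] [ν.IsInvInvariant]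
    {𝓕 : Set ↥(adelicUnipotent (↥(maximalRealSubfield L)) L (IsCMField.complexConj L) 2)}
    (h𝓕N : IsFundamentalDomain ↥(rationalUnipotent (↥(maximalRealSubfield L)) L (IsCMField.complexConj L) 2) 𝓕 ν) (h𝓕c : IsCompact (closure 𝓕)) (h𝓕₀ : ν 𝓕 ≠ 0)
    {β : (quasiSplit (↥(maximalRealSubfield L)) L (IsCMField.complexConj L) 2).Adelic → ℝ≥0∞}
    (hβ : IsCoveringWeight ↥((arithmeticBorel (↥(maximalRealSubfield L)) L (IsCMField.complexConj L) 2).map (quasiSplit (↥(maximalRealSubfield L)) L (IsCMField.complexConj L) 2).arithmeticSubgroup.subtype) β)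
    {μZ : Measure (borelQuotient (↥(maximalRealSubfield L)) L (IsCMField.complexConj L) 2)} [SFinite μZ]
    (hμZ : ∀ f : borelQuotient (↥(maximalRealSubfield L)) L (IsCMField.complexConj L) 2 → ℝ≥0∞, Measurable f → ∫⁻ z, f z ∂μZ = ∫⁻ g, β g * f (toBorelQuotient (↥(maximalRealSubfield L)) L (IsCMField.complexConj L) 2 g) ∂νG)
    (n : ℕ)
    -- ── the ball's CONVOLUTION DATA as binders (★ `exists_convData_cm_two` ∕ ★ `exists_chi_convData_cm_two` clauses, verbatim) ──
    {I : Type} [Fintype I] (i₀ : I) (η : I → GL (Fin 2) (AdeleRing (𝓞 L) L) → ℝ) {a : ℝ≥0} (ha : 0 < a) (κ : I → ℝ≥0)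
    (T : I → HX (↥(maximalRealSubfield L)) L (IsCMField.complexConj L) 2 (n + 3) μ →L[ℂ] HX (↥(maximalRealSubfield L)) L (IsCMField.complexConj L) 2 (n + 3) μ)
    -- the EIGENVALUE FUNCTIONS (★ convData_χ's `ŝ i`: entire, one non-constant member)
    (ŝ : I → ℂ → ℂ) (hŝ : ∀ i, Differentiable ℂ (ŝ i)) (hnc : ∃ z₁ z₂ : ℂ, ŝ i₀ z₁ ≠ ŝ i₀ z₂)
    (hη : ∀ i, IsTestFunctionGL 2 L (η i))
    (hconv : ∀ i, Continuous ((fun (i : I) (y : (quasiSplit (↥(maximalRealSubfield L)) L (IsCMField.complexConj L) 2).Adelic) => orbitalSmoothing νG (fun x : (quasiSplit (↥(maximalRealSubfield L)) L (IsCMField.complexConj L) 2).Adelic => ((η i (adelicVal (↥(maximalRealSubfield L)) L (IsCMField.complexConj L) 2 ((StdForm.antidiagonal 2).over L) x) : ℝ) : ℂ)) (fun x : (quasiSplit (↥(maximalRealSubfield L)) L (IsCMField.complexConj L) 2).Adelic => ((η i (adelicVal (↥(maximalRealSubfield L)) L (IsCMField.complexConj L) 2 ((StdForm.antidiagonal 2).over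 L) x) : ℝ) : ℂ)) y) i) ∧ HasCompactSupport ((fun (i : I) (y : (quasiSplit (↥(maximalRealSubfield L)) L (IsCMField.complexConj L) 2).Adelic) => orbitalSmoothing νG (fun x : (quasiSplit (↥(maximalRealSubfield L)) L (IsCMField.complexConj L) 2).Adelic => ((η i (adelicVal (↥(maximalRealSubfield L)) L (IsCMField.complexConj L) 2 ((StdForm.antidiagonal 2).over L) x) : ℝ) : ℂ)) (fun x : (quasiSplit (↥(maximalRealSubfield L)) L (IsCMField.complexConj L) 2).Adelic => ((η i (adelicVal (↥(maximalRealSubfield L)) L (IsCMField.complexConj L) 2 ((StdForm.antidiagonal 2).over L) x) : ℝ) : ℂ)) y) i) ∧ (∀ g, (fun (i : I) (y : (quasiSplit (↥(maximalRealSubfield L)) L (IsCMField.complexConj L) 2).Adelic) => orbitalSmoothing νG (fun x : (quasiSplit (↥(maximalRealSubfield L)) L (IsCMField.complexConj L) 2).Adelic => ((η i (adelicVal (↥(maximalRealSubfield L)) L (IsCMField.complexConj L) 2 ((StdForm.antidiagonal 2).over L) x) : ℝ) : ℂ)) (fun x : (quasiSplit (↥(maximalRealSubfield L)) L (IsCMField.complexConj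 L) 2).Adelic => ((η i (adelicVal (↥(maximalRealSubfield L)) L (IsCMField.complexConj L) 2 ((StdForm.antidiagonal 2).over L) x) : ℝ) : ℂ)) y) i g⁻¹ = (fun (i : I) (y : (quasiSplit (↥(maximalRealSubfield L)) L (IsCMField.complexConj L) 2).Adelic) => orbitalSmoothing νG (fun x : (quasiSplit (↥(maximalRealSubfield L)) L (IsCMField.complexConj L) 2).Adelic => ((η i (adelicVal (↥(maximalRealSubfield L)) L (IsCMField.complexConj L) 2 ((StdForm.antidiagonal 2).over L) x) : ℝ) : ℂ)) (fun x : (quasiSplit (↥(maximalRealSubfield L)) L (IsCMField.complexConj L) 2).Adelic => ((η i (adelicVal (↥(maximalRealSubfield L)) L (IsCMField.complexConj L) 2 ((StdForm.antidiagonal 2).over L) x) : ℝ) : ℂ)) y) i g) ∧ (∀ g, conj ((fun (i : I) (y : (quasiSplit (↥(maximalRealSubfield L)) L (IsCMField.complexConj L) 2).Adelic) => orbitalSmoothing νG (fun x : (quasiSplit (↥(maximalRealSubfield L)) L (IsCMField.complexConj L) 2).Adelic => ((η i (adelicVal (↥(maximalRealSubfield L)) L (IsCMField.complexConj L) 2 ((StdForm.antidiagonal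 2).over L) x) : ℝ) : ℂ)) (fun x : (quasiSplit (↥(maximalRealSubfield L)) L (IsCMField.complexConj L) 2).Adelic => ((η i (adelicVal (↥(maximalRealSubfield L)) L (IsCMField.complexConj L) 2 ((StdForm.antidiagonal 2).over L) x) : ℝ) : ℂ)) y) i g) = (fun (i : I) (y : (quasiSplit (↥(maximalRealSubfield L)) L (IsCMField.complexConj L) 2).Adelic) => orbitalSmoothing νG (fun x : (quasiSplit (↥(maximalRealSubfield L)) L (IsCMField.complexConj L) 2).Adelic => ((η i (adelicVal (↥(maximalRealSubfield L)) L (IsCMField.complexConj L) 2 ((StdForm.antidiagonal 2).over L) x) : ℝ) : ℂ)) (fun x : (quasiSplit (↥(maximalRealSubfield L)) L (IsCMField.complexConj L) 2).Adelic => ((η i (adelicVal (↥(maximalRealSubfield L)) L (IsCMField.complexConj L) 2 ((StdForm.antidiagonal 2).over L) x) : ℝ) : ℂ)) y) i g) ∧ (∀ g, 0 ≤ ((fun (i : I) (y : (quasiSplit (↥(maximalRealSubfield L)) L (IsCMField.complexConj L) 2).Adelic) => orbitalSmoothing νG (fun x : (quasiSplit (↥(maximalRealSubfield L)) L (IsCMField.complexConj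 L) 2).Adelic => ((η i (adelicVal (↥(maximalRealSubfield L)) L (IsCMField.complexConj L) 2 ((StdForm.antidiagonal 2).over L) x) : ℝ) : ℂ)) (fun x : (quasiSplit (↥(maximalRealSubfield L)) L (IsCMField.complexConj L) 2).Adelic => ((η i (adelicVal (↥(maximalRealSubfield L)) L (IsCMField.complexConj L) 2 ((StdForm.antidiagonal 2).over L) x) : ℝ) : ℂ)) y) i g).re))
    (hcov : ∀ z ∈ Metric.ball (0 : ℂ) (n + 2), ∃ i, (ŝ i z) ≠ 0)
    (hκ : ∀ i, 1 ≤ κ i ∧ a ≤ κ i * a)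
    (hcmp : ∀ i, ∀ z : borelQuotient (↥(maximalRealSubfield L)) L (IsCMField.complexConj L) 2, ∀ y ∈ tsupport ((fun (i : I) (y : (quasiSplit (↥(maximalRealSubfield L)) L (IsCMField.complexConj L) 2).Adelic) => orbitalSmoothing νG (fun x : (quasiSplit (↥(maximalRealSubfield L)) L (IsCMField.complexConj L) 2).Adelic => ((η i (adelicVal (↥(maximalRealSubfield L)) L (IsCMField.complexConj L) 2 ((StdForm.antidiagonal 2).over L) x) : ℝ) : ℂ)) (fun x : (quasiSplit (↥(maximalRealSubfield L)) L (IsCMField.complexConj L) 2).Adelic => ((η i (adelicVal (↥(maximalRealSubfield L)) L (IsCMField.complexConj L) 2 ((StdForm.antidiagonal 2).over L) x) : ℝ) : ℂ)) y) i),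
      borelQuotHeight (↥(maximalRealSubfield L)) L (IsCMField.complexConj L) 2 z ≤ κ i * borelQuotHeight (↥(maximalRealSubfield L)) L (IsCMField.complexConj L) 2 (rightShift (↥(maximalRealSubfield L)) L (IsCMField.complexConj L) 2 y z))
    (hι : ∀ i, ∃ hpos : 0 < κ i * a, Function.Injective (iota (iotaBound_cm L μ νG hβ hμZ hpos (n + 3))) ∧
      IsClosed ((LinearMap.range (iota (iotaBound_cm L μ νG hβ hμZ hpos (n + 3))).toLinearMap : Submodule ℂ (HN (↥(maximalRealSubfield L)) L (IsCMField.complexConj L) 2 (n + 3) (κ i * a) μZ)) : Set (HN (↥(maximalRealSubfield L)) L (IsCMField.complexConj L) 2 (n + 3) (κ i * a) μZ)))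
    (hT : ∀ i, ∀ u : HX (↥(maximalRealSubfield L)) L (IsCMField.complexConj L) 2 (n + 3) μ, ((T i u : HX (↥(maximalRealSubfield L)) L (IsCMField.complexConj L) 2 (n + 3) μ) : (quasiSplit (↥(maximalRealSubfield L)) L (IsCMField.complexConj L) 2).automorphicQuotient → ℂ) =ᵐ[(μ.withDensity fun x => (((supHeight (↥(maximalRealSubfield L)) L (IsCMField.complexConj L) 2 x)⁻¹ ^ (2 * (n + 3)) : ℝ≥0) : ℝ≥0∞))] fun ξ => ∫ y, (fun (i : I) (y : (quasiSplit (↥(maximalRealSubfield L)) L (IsCMField.complexConj L) 2).Adelic) => orbitalSmoothing νG (fun x : (quasiSplit (↥(maximalRealSubfield L)) L (IsCMField.complexConj L) 2).Adelic => ((η i (adelicVal (↥(maximalRealSubfield L)) L (IsCMField.complexConj L) 2 ((StdForm.antidiagonal 2).over L) x) : ℝ) : ℂ)) (fun x : (quasiSplit (↥(maximalRealSubfield L)) L (IsCMField.complexConj L) 2).Adelic => ((η i (adelicVal (↥(maximalRealSubfield L)) L (IsCMField.complexConj L) 2 ((StdForm.antidiagonal 2).over L) x) : ℝ) : ℂ))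 y) i y * (u : (quasiSplit (↥(maximalRealSubfield L)) L (IsCMField.complexConj L) 2).automorphicQuotient → ℂ) (y⁻¹ • ξ) ∂νG)
    (hpack : ∀ i, ∃ hs : ShiftBound (↥(maximalRealSubfield L)) L (IsCMField.complexConj L) 2 (n + 3) a (κ i * a) νG μZ ((fun (i : I) (y : (quasiSplit (↥(maximalRealSubfield L)) L (IsCMField.complexConj L) 2).Adelic) => orbitalSmoothing νG (fun x : (quasiSplit (↥(maximalRealSubfield L)) L (IsCMField.complexConj L) 2).Adelic => ((η i (adelicVal (↥(maximalRealSubfield L)) L (IsCMField.complexConj L) 2 ((StdForm.antidiagonal 2).over L) x) : ℝ) : ℂ)) (fun x : (quasiSplit (↥(maximalRealSubfield L)) L (IsCMField.complexConj L) 2).Adelic => ((η i (adelicVal (↥(maximalRealSubfield L)) L (IsCMField.complexConj L) 2 ((StdForm.antidiagonal 2).over L) x) : ℝ) : ℂ)) y) i),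
      ∀ h01 : a ≤ κ i * a, deltaShift hs ∘L iota (iotaBound_cm L μ νG hβ hμZ ha (n + 3)) = restrHN (↥(maximalRealSubfield L)) L (IsCMField.complexConj L) 2 (n + 3) h01 μZ ∘L iota (iotaBound_cm L μ νG hβ hμZ ha (n + 3)) ∘L T i)
    -- the SYMMETRY LETTER of the eigenvalues (hsymm_τ)
    (hsym : ∀ i (z : ℂ), ŝ i (1 - z) = ŝ i z)
    -- ── the self-dual character, the level, and a linearly independent family of continuous bounded sections of `V(χ, K′, ω)` ──
    {χ : HeckeCharacter L} (hsd : reflectChar (IsCMField.complexConj L) χ = χ) {K' : Subgroup (quasiSplit (↥(maximalRealSubfield L)) L (IsCMField.complexConj L) 2).Adelic} {ω : ↥K' → ℂ}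
    {Λ : Type} [Fintype Λ] [DecidableEq Λ] {b : Λ → (quasiSplit (↥(maximalRealSubfield L)) L (IsCMField.complexConj L) 2).Adelic → ℂ} (hbV : ∀ k, b k ∈ chiSectionSpace χ K' ω)
    (hli : LinearIndependent ℂ b) (hbc : ∀ k, Continuous (b k)) {Mb : ℝ} (hbM : ∀ k x, ‖b k x‖ ≤ Mb)
    -- the tube scattering coordinates of every `b_k` along `b` and the scalar action of the `h_i` on every `f_z^{b_k}`
    (q : Λ → Λ → ℂ → ℂ)
    (hq : ∀ k, ∀ z ∈ Metric.ball (0 : ℂ) (n + 2), 1 < z.re → (∑ j, q k j z • b j) = ((((ν 𝓕).toReal⁻¹ : ℝ)) : ℂ) • (fun g : (quasiSplit (↥(maximalRealSubfield L)) L (IsCMField.complexConj L) 2).Adelic => (∫ v : ↥(adelicUnipotent (↥(maximalRealSubfield L)) L (IsCMField.complexConj L) 2), flatSectionU (b k) z ((quasiSplit (↥(maximalRealSubfield L)) L (IsCMField.complexConj L) 2).toAdelic (weylLongU ((IsCMField.complexConj L : L ≃ₐ[↥(maximalRealSubfield L)] L) : L →+* L) (rfl : (StdForm.antidiagonal 2).over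 L = (StdForm.antidiagonal 2).over L)) * ((v : (quasiSplit (↥(maximalRealSubfield L)) L (IsCMField.complexConj L) 2).Adelic) * g)) ∂ν) * (((borelHeight g : ℝ) : ℂ) ^ (z - 1))))
    (hact : ∀ k i (z : ℂ), 1 < z.re → ∀ x : (quasiSplit (↥(maximalRealSubfield L)) L (IsCMField.complexConj L) 2).Adelic, (∫ y, (fun (i : I) (y : (quasiSplit (↥(maximalRealSubfield L)) L (IsCMField.complexConj L) 2).Adelic) => orbitalSmoothing νG (fun x : (quasiSplit (↥(maximalRealSubfield L)) L (IsCMField.complexConj L) 2).Adelic => ((η i (adelicVal (↥(maximalRealSubfield L)) L (IsCMField.complexConj L) 2 ((StdForm.antidiagonal 2).over L) x) : ℝ) : ℂ)) (fun x : (quasiSplit (↥(maximalRealSubfield L)) L (IsCMField.complexConj L) 2).Adelic => ((η i (adelicVal (↥(maximalRealSubfield L)) L (IsCMField.complexConj L) 2 ((StdForm.antidiagonal 2).over L) x) : ℝ) : ℂ)) y) i y * flatSectionU (b k) z (x * y) ∂νG) = (ŝ i z) * flatSectionU (b k) z x)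
    -- the global pieces (★ p860855 per `b_k`, pole sets united)
    {P : Set ℂ} {qc : Λ → Λ → ℂ → ℂ} (hPc : IsClosed P) (hPcd : ∀ z₀ : ℂ, ∀ᶠ s in 𝓝[≠] z₀, s ∉ P) (hPre : ∀ z ∈ P, z.re ≤ 1)
    (hqa : ∀ k j (z : ℂ), z ∉ P → AnalyticAt ℂ (qc k j) z) (hqcq : ∀ k j (z : ℂ), 1 < z.re → qc k j z = q k j z) :
    ∀ z : ℂ, z ∉ P → 1 - z ∉ P → ∀ j₀ j, ∑ k, qc j₀ k (1 - z) * qc k j z = if j = j₀ then 1 else 0 := by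
  classical
  intro z hz hz' j₀ j
  -- the family `b` is also a `χʷ`-family (self-duality)
  have hbχ' : ∀ k, IsChiSection (reflectChar (IsCMField.complexConj L) χ) (b k) := fun k => by rw [hsd]; exact isChiSection_of_mem (hbV k)
  -- ONE eigen ball package per basis element `b_k` (★ p860811), columns over the family `b` itself
  have P0 := fun k : Λ => exists_chi_ball_package_cm_two_of_eigen L μ νG ν h𝓕N h𝓕c h𝓕₀ hβ hμZ n i₀ η ha κ T ŝ hŝ hnc hη hconv hcov hκ hcmp hι hT hpack
    (hbV k) (hbc k) (hbM k) hli hbc hbχ' hbM (fun z j => q k j z) (fun z hzb hz1 => hq k z hzb hz1) (fun i z hz1 x => hact k i z hz1 x)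
  choose U vX cc hb α₁ col hUo hUD hDcl hUcd hvXd hvXm hccd hccm hα₁ae hcolae heqs hunq hgod hR4 using P0
  -- the columns of the different packages coincide (both a.e. `[f^{b_j}_{1−z}]`)
  have hcol : ∀ k j', ∀ w ∈ Metric.ball (0 : ℂ) (n + 2), col k j' w = col j₀ j' w := fun k j' w hw => swap_of_ae (hcolae k j' w hw) (hcolae j₀ j' w hw)
  -- the common holomorphy set `⋂_k U_k`
  have hUco : IsOpen (⋂ k, U k) := isOpen_iInter_of_finite fun k => hUo k
  have hUcD : (⋂ k, U k) ⊆ Metric.ball (0 : ℂ) (n + 2) := fun w hw => hUD j₀ (Set.mem_iInter.1 hw j₀)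
  have hUccd : ∀ z₀ ∈ Metric.ball (0 : ℂ) (n + 2), ∀ᶠ s in 𝓝[≠] z₀, s ∈ ⋂ k, U k := fun z₀ hz₀ =>
    (Filter.eventually_all.2 fun k => hUcd k z₀ hz₀).mono fun s hs => Set.mem_iInter.2 hs
  -- the χ-family equations on `⋂_k U_k` with the common columns `col j₀` (`IotaBound` is a `Prop`: all `iota (hb k)` coincide)
  have heqsC : ∀ k, ∀ w ∈ ⋂ k, U k, (∀ i, T i (vX k w) = (ŝ i w) • vX k w) ∧
      cnstN (↥(maximalRealSubfield L)) L (IsCMField.complexConj L) 2 (n + 3) a μZ (iota (hb j₀) (vX k w)) = (1 : ℂ) • α₁ k w +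
        (∑ j', (ContinuousLinearMap.proj (R := ℂ) (φ := fun _ : Λ => ℂ) j').smulRight (col j₀ j' w) : (Λ → ℂ) →L[ℂ] HN (↥(maximalRealSubfield L)) L (IsCMField.complexConj L) 2 (n + 3) a μZ) (cc k w) := fun k w hw => by
    have hwk : w ∈ U k := Set.mem_iInter.1 hw k
    refine ⟨(heqs k w hwk).1, ?_⟩
    have hsum : (∑ j', (ContinuousLinearMap.proj (R := ℂ) (φ := fun _ : Λ => ℂ) j').smulRight (col j₀ j' w) : (Λ → ℂ) →L[ℂ] HN (↥(maximalRealSubfield L)) L (IsCMField.complexConj L) 2 (n + 3) a μZ) =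
        ∑ j', (ContinuousLinearMap.proj (R := ℂ) (φ := fun _ : Λ => ℂ) j').smulRight (col k j' w) :=
      Finset.sum_congr rfl fun j' _ => by rw [hcol k j' w (hUD k hwk)]
    rw [hsum]
    exact (heqs k w hwk).2
  have huniqC : ∀ w ∈ ⋂ k, U k, ∀ (ψ : HX (↥(maximalRealSubfield L)) L (IsCMField.complexConj L) 2 (n + 3) μ) (bb : Λ → ℂ), (∀ i, T i ψ = (ŝ i w) • ψ) →
      cnstN (↥(maximalRealSubfield L)) L (IsCMField.complexConj L) 2 (n + 3) a μZ (iota (hb j₀) ψ) = (1 : ℂ) • α₁ j₀ w +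
        (∑ j', (ContinuousLinearMap.proj (R := ℂ) (φ := fun _ : Λ => ℂ) j').smulRight (col j₀ j' w) : (Λ → ℂ) →L[ℂ] HN (↥(maximalRealSubfield L)) L (IsCMField.complexConj L) 2 (n + 3) a μZ) bb →
        ψ = vX j₀ w ∧ bb = cc j₀ w := fun w hw => hunq j₀ w (Set.mem_iInter.1 hw j₀)
  -- the swap identities (`Lp.ext` of the a.e. clauses, as in ★ p860766)
  have hsw₁ : ∀ w ∈ ⋂ k, U k, 1 - w ∈ U j₀ → α₁ j₀ (1 - w) = col j₀ j₀ w := fun w hw h1w =>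
    swap_of_ae (hα₁ae j₀ (1 - w) (hUD j₀ h1w)) (hcolae j₀ j₀ w (hUcD hw))
  have hsw₂ : ∀ w ∈ ⋂ k, U k, 1 - w ∈ U j₀ → ∀ k, col j₀ k (1 - w) = α₁ k w := fun w hw h1w k => by
    have h := hcolae j₀ k (1 - w) (hUD j₀ h1w)
    rw [sub_sub_cancel] at h
    exact swap_of_ae h (hα₁ae k w (hUcD hw))
  -- the tube agreement (Godement clause + `hqcq`)
  have hagree : ∀ k j', ∀ w ∈ ⋂ k, U k, 1 < w.re → cc k w j' = qc k j' w := fun k j' w hw hw1 => by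
    rw [(hgod k w (Set.mem_iInter.1 hw k) hw1).2, hqcq k j' w hw1]
  have hagree' : ∀ k, ∀ w ∈ U j₀, 1 < w.re → cc j₀ w k = qc j₀ k w := fun k w hw hw1 => by
    rw [(hgod j₀ w hw hw1).2, hqcq j₀ k w hw1]
  -- ★ ED.2 with the χ-family on `⋂_k U_k` and the package of `b_{j₀}` as the dual package
  exact chi_scattering_matrix_fe_cm_two_of_eigen L νG (hb j₀) ŝ hsym T j₀ j₀ hUco hUcD hUccd (vX := vX) (cc := cc) (fun k => (hccd k).mono (Set.iInter_subset U k))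
    (α₁ := α₁) (col := col j₀) heqsC huniqC (hUo j₀) (hUD j₀) (hUcd j₀) (hccd j₀) (heqs j₀) hsw₁ hsw₂
    hPc hPcd hPre hqa hPc hPcd hPre (fun k w hw => hqa j₀ k w hw) hagree hagree' z hz hz' j

end Summit.HodgeConjecture.HodgeConjecture.Cruxes.H413.K2E1ChiScatteringMatrixFunctionalEquationLevelCMTwo

end
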